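import Mathlib
import HarnessLib
import HarnessLib.Audit
import Summits.QuantumAdvantage.Statement
import Literature.Computability.QuantumComplexity.SimUniformity
import HarnessLib.Audit.Status.Attr

/-!
Route: MeasureZeroOne

DORMANT since 2026-08-26T13:39:10Z (reconciler: no traction for 7 d (last activity item-proof-filed at 2026-08-19T13:58:52Z); parked, not closed — `ledger route dormant route-QuantumAdvantage-MeasureZeroOne --off` to reactivate) — unstaffed, not closed; items shared with open routes are served there. `ledger route dormant <id> --off` reactivates.

# Route QuantumAdvantage/MeasureZeroOne — existence by measure: BQP breaks the resource-bounded
zero-one law (idea card measure-zero-one-route)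

## Thesis X ("it suffices to show X")
Words: BQP is neither NEGLIGIBLE nor EVERYTHING inside exponential time: (a) BQP does not have
p-measure zero — no single
martingale d : {0,1}* → ℚ≥0, computed exactly in time polynomial in the length N = |w| of the
characteristic-sequence
prefix it bets on (Lutz 1992; van Melkebeek 2000, Def. 2.5.1: "E-measure", time 2^{O(n)} =
N^{O(1)}), succeeds
(unbounded capital) on every BQP language — and (b) BQP ≠ EXP.
Lean: `Target := (¬ PMZ BQP) ∧ Literature.Computability.Cryptography.BQP ≠
Literature.Computability.Complexity.EXP`, where
`PMZ C` is INLINED in every item that needs it (no Literature notion yet; definition requested) as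
`∃ d : List Bool → ℚ, (∀ w, 0 ≤ d w) ∧ (∀ w, d (w ++ [false]) + d (w ++ [true]) = 2 * d w) ∧
 Literature.Computability.Complexity.PolyTimeComputable (fun w => w) (fun q : ℚ =>
(encodingIntBool.pairBool encodingNatBool).encode (q.num, q.den)) d ∧
 ∀ L ∈ C, ∀ c : ℕ, ∃ N : ℕ, (c : ℚ) < d ((List.range N).map fun i => decide ((Nat.bits
(i+1)).reverse.tail ∈ L))`
(the i-th string of the standard lexicographic enumeration is `(Nat.bits (i+1)).reverse.tail`: [],
0, 1, 00, 01, 10, 11, …; checked by `decide`).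

## Why X → QuantumAdvantage (the Assembly, provable now)
van Melkebeek's ZERO-ONE LAW FOR BPP (VanMelkebeek2000 Thm 6.1.1 = VanMelkebeekTCS2000; engine:
ImpagliazzoWigderson2001):
μ_p(BPP) = 0 ∨ BPP = EXP. If ¬S then BQP ⊆ BPP, and with the PROVED tree fact `BPP_subset_BQP_holds`
BQP = BPP inherits the
law; (a) then forces BPP = EXP = BQP, contradicting (b). `Assembly := ZeroOneLawBPP → BQPNotSmall →
BQPneEXP → QuantumAdvantage`
(two lines after `rw [BQP = BPP]`; elaborated and proved in the planner's Sketch.lean against `BPP ⊆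
BQP`).
No witness language is named anywhere: an existence-by-measure proof shape for the existential
summit.

## Honest status
CONDITIONAL in substance (not flagged --conditional-bridge: 4 cruxes): the load-bearing hypotheses
are the quantum measure
hypothesis QMH = `BQPNotSmall` (new, hypothesis-type) and `BQPneEXP` (standard, hypothesis-type;
needs non-relativizing ideas,
Heller1986). QMH is STRONGER than the pointwise hypothesis of card exp-dichotomy (QMH ⟹ some BQP
language is not
io-2/3-approximable on uniform inputs by DTIME(2^n) languages). Earned mathematics: `ZeroOneLawBPP`
(Lutz measure + vM00 + IW98
in Lean, reusable by PneNP's Lutz-hypothesis lines), the theorem-shaped ¬X `ZeroOneLawBQP` ("is BQP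
measurable in EXP?" —
implied by ¬S, hence a necessary condition for route Dequantize), and the calibration items
`PSmall`, `ENotSmall`.

Rationale: WHY THIS LINE. Imported area: resource-bounded measure (Lutz1992; VanMelkebeek2000 ch. 2, 6) —
martingale/betting arguments on the
Cantor space of languages, the complexity-theoretic form of "existence by measure". The one
complexity class with a proved zero-one
law is BPP (VanMelkebeek2000 Thm 6.1.1, via ImpagliazzoWigderson2001); pointing it at the summit
along ¬S gives a witness-free
sufficient condition (QMH ∧ BQP ≠ EXP) of a TYPE absent from the tree (class-level size, not
hardness of one problem), and poses the
crisp new question "does BQP obey the p-measure zero-one law?" (HitchcockSekoniShafei2025 p.4: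
quantum classes had not been
addressed by resource-bounded measure; their Thm 4.7/4.8, Cor 4.10 give only COUNTING (GapP)
martingales covering BQP via BQP ⊆ AWPP).
Catalogue used: probabilistic/measure model on language space (thought-starter 27/16); no physical
analogy.

RANKED CRUXES (decls of Theses/MeasureZeroOne.lean; PMZ = the inlined p-measure-zero formula of the
thesis):
 r2 ZeroOneLawBPP   `PMZ BPP ∨ BPP = EXP` — vM00 Thm 6.1.1 (⇐) as a statement to DISCHARGE; FIRST
crux by the plancard rule (the bridge's
    one unlanded named fact). Known theorem; the work is IW98 (uniform hardness vs randomness) +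
Lutz's E-uniform union lemma in Lean.
 r3 BQPNotSmall     `¬ PMZ BQP` — QMH, the quantum Lutz hypothesis; load-bearing, hypothesis-type
(implies BQP ⊄ DTIME(2^{cn}) ∀c).
 r4 ZeroOneLawBQP   `PMZ BQP ∨ BQP = EXP` — ¬X, theorem-shaped: a proof is a UNIFORM DEQUANTIZATION
from BQP ≠ EXP (one E-time gambler
    out-guesses every quantum poly-time language) and closes this route; implied by ¬S, so also a
necessary condition for Dequantize.
 r5 BQPneEXP        `BQP ≠ EXP` — standard, hypothesis-type; non-relativizing (Heller1986: a world
with BPP = EXP).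
 r0 Target = BQPNotSmall ∧ BQPneEXP; r1 Assembly; support r9: Dichotomy (`ZeroOneLawBPP →
BQPNotSmall → S ∨ BPP = EXP`, provable now),
 PSmall (`PMZ P`, Lutz1992 / VanMelkebeek2000 §2.5.3: calibrates the inline notion from below),
ENotSmall (`¬ PMZ E`, measure conservation:
 calibrates it from above — together they certify the inlined definition is neither vacuous nor
trivial).

KILL CRITERIA. ZeroOneLawBQP proved (any form: e.g. μ_p(BQP)=0 from BQP ≠ EXP by de-counting HSS25's
GapP martingale) ⟹ Target is
contradictory ⟹ close `refuted:Target` with the dequantization theorem as the census. A refuter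
showing the inline PMZ deviates from
Lutz/vM (e.g. PSmall false or ENotSmall false as typed) ⟹ restate all PMZ items over the corrected
formula (one edit). BQPneEXP or QMH
refuted outright would be epochal (BQP = EXP, resp. μ_p(BQP) = 0 ⟹ BQP ≠ EXP ∧ BPP ≠ EXP) — not
expected.

DELIBERATELY NOT DECOMPOSED (tenure, after r2 moves): split of ZeroOneLawBPP into [IW98 Thm 6.2.1
over `uniformProb`/`DTIME (2^n)`;
Lutz union lemma Thm 2.5.2; vM §6.2 martingale glue]; the p-DIMENSION refinement carried from
retired card quantum-lutz-hypothesis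
(dim_p(BQP) > 1/2 ∧ EXP ≠ BPP ⟹ S; reconcile with Moser2011) ; BPTIME calibration; Allender–Strauss
/ BatchP consequences of QMH;
quantum (sampling) martingales à la Regan–Sivakumar. Definition request filed: Literature notion
`PMeasureZero`
(Literature/Computability/Complexity/ResourceBoundedMeasure.lean); once it lands every PMZ item is
restated over it verbatim.

NOVELTY / BARRIERS: see the dedicated sections (searched 2026-08-15: zbMATH, Crossref, galaxy --star
all, lit frontier/bridges,
held texts VanMelkebeek2000 §2.5 Def 2.5.1-Thm 2.5.2 (lit chunks p0074-76) and ch. 6 pp. 141-144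
(chunks p0169-171), arXiv:2508.07619 §1.1, §4.4; OpenAlex/S2/arXiv APIs rate-limited, logged in
NOTES).

Novelty: NOVELTY (searched BEFORE claiming, 2026-08-15): zbMATH "resource-bounded measure quantum BQP" → only
HitchcockSekoniShafei2025
(doi:10.4230/lipics.ccc.2025.20 = arXiv:2508.07619) and its MFCS 2025 companion arXiv:2511.08786;
zbMATH "zero-one law resource-bounded
measure probabilistic class" → VanMelkebeek2000 only; Crossref "resource-bounded measure on
probabilistic classes" / "zero-one law for RP …"
/ "quantum resource-bounded measure martingale …" → Moser 2008 (doi:10.1016/j.ipl.2007.11.019),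
ImpagliazzoMoser2009, Moser2011, Dai 2001/2003
(Kolmogorov 0-1 law for p-measure, doi:10.1016/s0304-3975(02)00320-1), ArvindKobler2001,
Köbler–Lindner 1998 (measure of P/poly), nothing quantum;
galaxy --star all substring "measure of BQP", "zero-one law for BQP", "BQP has measure" → 0 hits
each; `lit frontier QuantumAdvantage --since 2020`
and `lit bridges --cross any` → no measure/zero-one items; held texts read: VanMelkebeek2000 §2.5 +
ch. 6 (Thm 6.1.1, 6.1.2, 6.2.1, §6.4 open
questions), arXiv:2508.07619 §1.1 (p0004: "Until now, quantum complexity has not been addressed by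
resource-bounded measure"), §4.4 (p-measure of
BPP open; GapP-measure of BQP = 0, Thm 4.7/4.8, Cor 4.10), §7 open questions (counting measures
only). OpenAlex/S2/arXiv APIs were rate-limited
(429) this session — logged, not relied on.
NEAREST PRIOR ART: VanMelkebeekTCS2000 / VanMelkebeek2000 Thm 6.1.1 (the law for BPP — the engine);
HitchcockSekoniShafei2025 (measure reaches BQP,
but with COUNTING martingales, no  [refs: 10.4230/lipics.ccc.2025.20, 10.1016/j.ipl.2007.11.019, 10.1016/s0304-3975(02, 2508.07619, 2511.08786, doi:10.4230/lipics.ccc.2025.20, doi:10.1016/j.ipl.2007.11.019, doi:10.1016/s0304-3975, HitchcockSekoniShafei2025, VanMelkebeek2000, ImpagliazzoMoser2009, Moser2011, ArvindKobler2001, VanMelkebeekTCS2000]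

Barriers (technique_class: lutz-measure, conditional-bridge, class-separation): technique_class: lutz-measure, conditional-bridge, class-separation (also: derandomization,
diagonalization)
- Literature.Barriers.QuantumAdvantage.SeparationPrerequisites: APPLIES in full to the S-side —
Target ⟹ S ⟹ PP ⊄ BPP ∧ P ≠ PSPACE, and more: QMH alone ⟹ BQP ⊄ DTIME(2^{cn}) for every c, and even
the ¬-side smallness μ_p(BQP) = 0 ⟹ BQP ≠ EXP ∧ BPP ≠ EXP (measure conservation) — NOT evaded: the
separation strength is relocated onto the hypothesis-type cruxes BQPNotSmall / BQPneEXP exactly as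
route Shor relocates it onto FACT ∉ BPP; the only items claimed provable now are Assembly,
Dichotomy, ZeroOneLawBPP (a theorem in print) and the calibrations. The theorem-shaped ¬X
ZeroOneLawBQP is a DISJUNCTION with BQP = EXP and therefore implies no separation (vM proved the BPP
instance unconditionally): it is the one research item outside this barrier's scope.
- Literature.Barriers.QuantumAdvantage.Relativization: the Assembly and Dichotomy are two-line set
manipulations and relativize; vM's law relativizes to the extent IW98 does (IW98's EXP-learning step
uses an EXP-complete downward/random-self-reducible function — treated as relativizing folklore,
recorded as an open check for the refuter); hence a proof of Target cannot relativize (Target ⟹ S,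
and BQP^A ⊆ BPP^A for PSPACE-complete A), and neither can a proof of BQPneEXP (Heller1986: an oracle
world with BPP = EXP, hence BQP = EXP there). ZeroOneLawBQP: relative to a PSPACE-complete oracle it
holds trivially (BQP^A = P^A is

Novelty grade: variant — ROUTE REVIEW (refuter bc059723, 2026-08-15). VARIANT of the Lutz measure-hypothesis template with the class changed NP ↦ BQP. Prior art READ (held vM LNCS 1950 p.169): Thm 6.1.1 'BPP has E-measure zero iff BPP ≠ EXP', Thm 6.1.2/Cor 6.1.2 (tt-closed C ⊆ BPP), Regan–Sivakumar–Cai (strong PRGs ⟹ zero-o (refuter refuter-rreview-route-HodgeConjecture-Pa-bc059723-0, 2026-08-15T13:59:33Z; prior: VanMelkebeek2000 Thm 6.1.1/6.1.2 p.169; Lutz1992; arXiv:2508.07619; ReganSivakumarCai1995)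

History (route lifecycle, newest last):
- 2026-08-26T13:39:10Z · DORMANT — reconciler: no traction for 7 d (last activity item-proof-filed at 2026-08-19T13:58:52Z); parked, not closed — `ledger route dormant route-QuantumAdvantage-Meas (operator:999:3114400)

sub-problem: QuantumAdvantage · status: dormant · opened planner-plancard-QuantumAdvantage-QuantumAdva-40ba59b3-0 2026-08-15T10:55:01Z · rev 2 · ledger route-QuantumAdvantage-MeasureZeroOne
GENERATED by the gate from the ledger (D-0016/17). Provers cite these decls: `theorem foo : Summit.QuantumAdvantage.QuantumAdvantage.Theses.MeasureZeroOne.<Decl> := …` in Summits/QuantumAdvantage/QuantumAdvantage/Theorems/<Name>.lean.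
-/

namespace Summit.QuantumAdvantage.QuantumAdvantage.Theses.MeasureZeroOne

open scoped BigOperators Topology Manifold Classical MeasureTheory ProbabilityTheory Matrix InnerProductSpace ComplexConjugate ContinuousMap
open Filter Set Function TopologicalSpace MeasureTheory

attribute [summit_statement] _root_.QuantumAdvantage

open Literature.QuantumAdvantage

/-- item stmt-QuantumAdvantage-1350 · target · rank 0 · open · by planner
why it might fail: False iff BQP obeys the zero-one law (crux ZeroOneLawBQP: BQP ≠ EXP ⟹ μ_p(BQP)=0, e.g. by de-counting HSS25's GapP martingale Thm 4.7/4.8) or BQP = EXP. Hypothesis-type: Target ⟹ S ⟹ P ≠ PSPACE; QMH alone ⟹ BQP ⊄ DTIME(2^{cn}) ∀c (Lutz92) — SeparationPrerequisites applies in full.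
sources: VanMelkebeek2000, HitchcockSekoniShafei2025, arXiv:2508.07619, Lutz1992, Literature.Barriers.QuantumAdvantage.SeparationPrerequisites
[target] Thesis X of route MeasureZeroOne: BQP BREAKS the p-measure zero-one law — no
exactly-computed rational martingale running in time polynomial in the prefix length N = |w| (Lutz
p-measure = van Melkebeek's E-measure, VanMelkebeek2000 Def 2.5.1/§2.5.2) succeeds on every language
of Literature.Computability.Cryptography.BQP (first conjunct = crux BQPNotSmall, QMH), and BQP ≠ EXP
(second conjunct = crux BQPneEXP). X → QuantumAdvantage is the Assembly (needs only ZeroOneLawBPP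
and the proved BPP ⊆ BQP). Literally `BQPNotSmall ∧ BQPneEXP` (Iff.rfl) and `ZeroOneLawBQP → ¬
Target`. Hypothesis-type as a whole; nobody is expected to prove Target outright (Target ⟹ S ⟹ P ≠
PSPACE). -/
@[route_item "route-QuantumAdvantage-MeasureZeroOne"]
def Target : Prop :=
  (¬ ∃ d : List Bool → ℚ, (∀ w, 0 ≤ d w) ∧ (∀ w, d (w ++ [false]) + d (w ++ [true]) = 2 * d w) ∧ Literature.Computability.Complexity.PolyTimeComputable (fun w : List Bool => w) (fun q : ℚ => (Literature.Computability.Complexity.encodingIntBool.pairBool Computability.encodingNatBool).encode (q.num, q.den)) d ∧ ∀ L ∈ Literature.Computability.Cryptography.BQP, ∀ c : ℕ, ∃ N : ℕ, (c : ℚ) < d ((List.range N).map fun i => decide ((Nat.bits (i + 1)).reverse.tail ∈ L))) ∧ Literature.Computability.Cryptography.BQP ≠ Literature.Computability.Complexity.EXP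

/-- item stmt-QuantumAdvantage-1352 · crux · rank 3 · open · by planner
why it might fail: μ_p(BQP)=0 is live: false outright if BQP ⊆ DTIME(2^{cn}) for some c (Lutz92, vM p.47); an abstain-and-certify 2^{O(n)}-time bettor already covers Shor-seed languages, BQP∩DTIME(2^{kn}), O(n)-qubit families (rreview bc059723): QMH needs BQP languages a.e.-unpredictable in time 2^{kn} ∀k; none known.
sources: Lutz1992, HitchcockSekoniShafei2025, arXiv:2508.07619, VanMelkebeek2000, ImpagliazzoMoser2009, ArvindKobler2001
[crux] QMH, the QUANTUM MEASURE HYPOTHESIS (quantum twin of Lutz's μ_p(NP) ≠ 0): BQP does not have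
p-measure zero — for every exactly-computed rational martingale d running in time polynomial in the
prefix length there is a BQP language on whose characteristic sequence d's capital stays bounded.
LOAD-BEARING and HYPOTHESIS-TYPE (like FACT ∉ BPP in route Shor): it implies BQP ⊄ DTIME(2^{cn}) for
every c, that BQP contains P-bi-immune and ≤m-incompressible languages (Mayordomo, Juedes–Lutz
measure-one packages), and — via vM's covering martingale — that some BQP language is not
io-2/3-approximated on uniform inputs by any DTIME(2^n) language (so QMH is STRONGER than card
exp-dichotomy's pointwise hypothesis). Heuristic support: seed-generated Shor languages {s : least
prime factor of G(s) ≡ 1 mod 4}, |G(s)| = |s|^4, are in BQP and plausibly defeat every 2^{O(n)}-time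
predictor even given all earlier answers (NFS costs 2^{|s|^{4/3}}). Expected work here: refuters
test the typing and vacuity (see PSmall/ENotSmall), chart consequences, and try the fastest
refutation below; provers do not attack it directly. -/
@[route_item "route-QuantumAdvantage-MeasureZeroOne", crux]
def BQPNotSmall : Prop :=
  ¬ ∃ d : List Bool → ℚ, (∀ w, 0 ≤ d w) ∧ (∀ w, d (w ++ [false]) + d (w ++ [true]) = 2 * d w) ∧ Literature.Computability.Complexity.PolyTimeComputable (fun w : List Bool => w) (fun q : ℚ => (Literature.Computability.Complexity.encodingIntBool.pairBool Computability.encodingNatBool).encode (q.num, q.den)) d ∧ ∀ L ∈ Literature.Computability.Cryptography.BQP, ∀ c : ℕ, ∃ N : ℕ, (c : ℚ) < d ((List.range N).map fun i => decide ((Nat.bits (i + 1)).reverse.tail ∈ L))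

/-- item stmt-QuantumAdvantage-1353 · crux · rank 4 · open · by planner
why it might fail: Fails iff Target (QMH ∧ BQP ≠ EXP). OPEN both ways: vM §6.1 p.141 'we do not know whether every complexity class within exponential time has measure zero or one' (only BPP and tt-closed C ⊆ BPP known, Thm 6.1.1/6.1.2); IW98 swaps coins for NW outputs, nothing dequantizes amplitudes; HSS25: GapP.
sources: VanMelkebeek2000, VanMelkebeekTCS2000, ImpagliazzoWigderson2001, HitchcockSekoniShafei2025, arXiv:2508.07619, ReganSivakumarCai1995
[crux][¬X] THE ZERO-ONE LAW FOR BQP — the route's research question and its kill switch: BQP has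
p-measure zero or BQP = EXP, i.e. BQP is 'measurable in EXP' in Lutz's sense (vM §6.1: 'we do not
know whether every complexity class within exponential time has measure zero or one'; the only
non-trivial positive instances in print are BPP, and classes inside BPP closed under tt-reductions,
vM Thm 6.1.2; RP/ZPP variants ImpagliazzoMoser2009). Equivalent to BQP ≠ EXP ⟹ μ_p(BQP) = 0: a proof
would be a UNIFORM 'hardness versus quantumness' theorem — from the mere separation BQP ≠ EXP, ONE
deterministic martingale running in time 2^{O(n)} out-guesses every quantum polynomial-time language
infinitely often with unbounded gain — the quantum IW98 that is conspicuously missing (PRGs replace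
coins, not amplitudes). It is implied by ¬S (BQP = BPP inherits vM's law), hence a NECESSARY
condition for route Dequantize and strictly weaker than BQP ⊆ BPP. Proving it closes THIS route
(Target becomes contradictory: `ZeroOneLawBQP → ¬ Target`); refuting it proves Target and the
summit. Natural first attempts: de-count HSS25's acceptance-probability GapP-martingale under BQP ≠
EXP (or under the stronger -/
@[route_item "route-QuantumAdvantage-MeasureZeroOne"]
def ZeroOneLawBQP : Prop :=
  (∃ d : List Bool → ℚ, (∀ w, 0 ≤ d w) ∧ (∀ w, d (w ++ [false]) + d (w ++ [true]) = 2 * d w) ∧ Literature.Computability.Complexity.PolyTimeComputable (fun w : List Bool => w) (fun q : ℚ => (Literature.Computability.Complexity.encodingIntBool.pairBool Computability.encodingNatBool).encode (q.num, q.den)) d ∧ ∀ L ∈ Literature.Computability.Cryptography.BQP, ∀ c : ℕ, ∃ N : ℕ, (c : ℚ) < d ((List.range N).map fun i => decide ((Nat.bits (i + 1)).reverse.tail ∈ L))) ∨ Literature.Computability.Cryptography.BQP = Literature.Computability.Complexity.EXP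

/-- item stmt-QuantumAdvantage-1354 · crux · rank 5 · open · by planner
why it might fail: Open separation, provable only non-relativizingly: Heller 1986 gives an oracle A with BPP^A = EXP^A, hence BQP^A = EXP^A (vM pp. 153, 161, 172); unrelativized, BQP ≠ EXP ⟹ BPP ≠ EXP, open since the 1970s. Believed true but can only be carried as a hypothesis; algebrization applies likewise.
sources: Heller1986, VanMelkebeek2000, Literature.Barriers.QuantumAdvantage.Relativization, Literature.Barriers.QuantumAdvantage.Algebrization, BernsteinVazirani1997SICOMP
[crux] BQP ≠ EXP — the second, standard load-bearing hypothesis (hypothesis-type). Universally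
believed (BQP ⊆ PP ⊆ PSPACE ⊆ EXP with at least one inclusion expected strict) but OPEN, and beyond
relativizing techniques: Heller1986 gives an oracle world with BPP = EXP (cited by vM p. 153), hence
BQP = EXP there. Note BQP ≠ EXP ⟹ BPP ≠ EXP ⟹ (by ZeroOneLawBPP) μ_p(BPP) = 0, so under this crux
the whole content of Target is 'BQP is not p-null although BPP is'. The tree proves BQP ⊆ EXP
(BQP_subset_PSPACE_holds, PSPACE_subset_EXP_holds); nothing here needs more. -/
@[route_item "route-QuantumAdvantage-MeasureZeroOne", crux]
def BQPneEXP : Prop :=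
  Literature.Computability.Cryptography.BQP ≠ Literature.Computability.Complexity.EXP

/-- item stmt-QuantumAdvantage-1351 · support · rank 2 · open · by planner
why it might fail: None as typed: theorem in print (vM LNCS 1950 Thm 6.1.1 ⇐) transcribed exactly (E-measure = time N^{O(1)}, exact rationals, Def 2.5.1 p.47; rreview audit). Residual risk = formalization size only: IW98 Thm 6.2.1 + union lemma 2.5.2 + clocked DTIME[2^n] enumeration in TM2; dyadic weights for Σ m⁻².
sources: VanMelkebeekTCS2000, VanMelkebeek2000, ImpagliazzoWigderson2001, Lutz1992, book:melkebeeknd-randomness-completeness-computational-complexity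
[crux] van Melkebeek's ZERO-ONE LAW FOR BPP, the direction the bridge needs (VanMelkebeek2000 Thm
6.1.1 ⇐, pp. 141–143 = VanMelkebeekTCS2000): BPP has p-measure zero or BPP = EXP. A THEOREM IN
PRINT, filed as the FIRST crux by the plancard rule because it is the bridge's one unlanded named
fact; its discharge is real work: Impagliazzo–Wigderson's uniform derandomization
(ImpagliazzoWigderson2001 = vM Thm 6.2.1: BPP ≠ EXP ⟹ every BPP language agrees with some DTIME(2^n)
language on > 2/3 of {0,1}^m for infinitely many m), vM's §6.2 martingale d_B = Σ_m m^{-2} d_{B,m}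
(bet 1/3 of capital on agreement with B at length m; gains (2^{5/3}/3)^{2^m}), and Lutz's E-uniform
union lemma (vM Thm 2.5.2) over a clocked enumeration of DTIME(2^n). p-measure is INLINED (exact
rational values, time poly(|w|), standard enumeration s_i = (Nat.bits (i+1)).reverse.tail) pending
the Literature notion PMeasureZero (definition requested); the exact-computation convention is vM
§2.5.2 ('one loses no generality by requiring rational values a/b computed within the bound').
Retriage may downgrade to support once the Literature fact lands; tenure split foreseen: [IW98 Thm
6.2.1 over uniformProb/DTIME; union lem -/
@[route_item "route-QuantumAdvantage-MeasureZeroOne", crux]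
def ZeroOneLawBPP : Prop :=
  (∃ d : List Bool → ℚ, (∀ w, 0 ≤ d w) ∧ (∀ w, d (w ++ [false]) + d (w ++ [true]) = 2 * d w) ∧ Literature.Computability.Complexity.PolyTimeComputable (fun w : List Bool => w) (fun q : ℚ => (Literature.Computability.Complexity.encodingIntBool.pairBool Computability.encodingNatBool).encode (q.num, q.den)) d ∧ ∀ L ∈ Literature.Computability.Complexity.BPP, ∀ c : ℕ, ∃ N : ℕ, (c : ℚ) < d ((List.range N).map fun i => decide ((Nat.bits (i + 1)).reverse.tail ∈ L))) ∨ Literature.Computability.Complexity.BPP = Literature.Computability.Complexity.EXP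

/-- item stmt-QuantumAdvantage-1355 · support · rank 9 · closed · proved by Summit.QuantumAdvantage.QuantumAdvantage.Theorems.MeasureZeroOne.dichotomy_proof @ a659f5798f2b (prover) · by planner
sources: VanMelkebeek2000, ArvindKobler2001
[support] The fork without the second hypothesis (card's M1): under vM's law, QMH alone gives
QuantumAdvantage ∨ BPP = EXP (if ¬S then BQP = BPP is not p-null, so BPP = EXP). PROVABLE NOW from
the proved tree fact BPP_subset_BQP_holds
(Literature/Computability/QuantumComplexity/SimUniformity.lean) by cases on S; proved in the
planner's Sketch. Records that under QMH the summit is EQUIVALENT to BPP ≠ EXP (the converse S ⟹ BPP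
≠ EXP being BQP ⊆ EXP). -/
@[route_item "route-QuantumAdvantage-MeasureZeroOne"]
def Dichotomy : Prop :=
  ZeroOneLawBPP → BQPNotSmall → (QuantumAdvantage ∨ Literature.Computability.Complexity.BPP = Literature.Computability.Complexity.EXP)

-- `Dichotomy` holds: proved by `Summit.QuantumAdvantage.QuantumAdvantage.Theorems.MeasureZeroOne.dichotomy_proof` @ a659f5798f2b (its module imports this route file, so no `_holds` link can be stated here).

/-- item stmt-QuantumAdvantage-1356 · support · rank 9 · open · by planner
sources: Lutz1992, VanMelkebeek2000
[support][calibration] P has p-measure zero for the INLINED notion (Lutz1992; VanMelkebeek2000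
§2.5.3: 'for any fixed c, DTIME[2^{cn}] has E-measure zero', via the E-uniform union lemma Thm 2.5.2
over a clocked enumeration of P and the all-in predictor martingales). Purpose: certify from BELOW
that the inline p-measure formula is not vacuous (some admissible martingale exists and succeeds on
a non-trivial class) — if this fails as typed (e.g. an encoding/halting-rule artefact makes
PolyTimeComputable into the ℚ-encoding unsatisfiable), every PMZ item must be restated. Needs a
universal clocked simulation in the tree's TM2 model (cf. TimeHierarchyInterpreter.lean). Cheaper
partial guards welcome via --supports (e.g. the singleton class {∅} is p-null: d(w) = 2^{|w|}·[w ∈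
0*]). -/
@[route_item "route-QuantumAdvantage-MeasureZeroOne"]
def PSmall : Prop :=
  ∃ d : List Bool → ℚ, (∀ w, 0 ≤ d w) ∧ (∀ w, d (w ++ [false]) + d (w ++ [true]) = 2 * d w) ∧ Literature.Computability.Complexity.PolyTimeComputable (fun w : List Bool => w) (fun q : ℚ => (Literature.Computability.Complexity.encodingIntBool.pairBool Computability.encodingNatBool).encode (q.num, q.den)) d ∧ ∀ L ∈ Literature.Computability.Complexity.Classes.P, ∀ c : ℕ, ∃ N : ℕ, (c : ℚ) < d ((List.range N).map fun i => decide ((Nat.bits (i + 1)).reverse.tail ∈ L))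

/-- item stmt-QuantumAdvantage-1357 · support · rank 9 · open · by planner
sources: Lutz1992, VanMelkebeek2000
[support][calibration] MEASURE CONSERVATION for the inlined notion: E = ⋃_c DTIME(2^{cn}) does not
have p-measure zero (Lutz1992; VanMelkebeek2000 §2.5.3 'μ_E(E) ≠ 0'): against a martingale d
computable in time |w|^k, the diagonal language that at each string picks the bit not increasing d
lies in DTIME(2^{(k+2)n}) ⊆ E and d never exceeds d(λ) on it. Purpose: certify from ABOVE that the
inline success clause is not trivially satisfiable (else every class would be 'null', QMH false as
typed and the route spuriously refuted). With PSmall it pins the inline definition between the two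
classical landmarks; also yields BPP = EXP → ¬PMZ BPP (the ⇒ half of vM Thm 6.1.1) and μ_p(BQP) = 0
→ BQP ≠ EXP by monotonicity. Cheaper partial guard via --supports: ¬ PMZ Set.univ (pure greedy
diagonalization, no machines). -/
@[route_item "route-QuantumAdvantage-MeasureZeroOne"]
def ENotSmall : Prop :=
  ¬ ∃ d : List Bool → ℚ, (∀ w, 0 ≤ d w) ∧ (∀ w, d (w ++ [false]) + d (w ++ [true]) = 2 * d w) ∧ Literature.Computability.Complexity.PolyTimeComputable (fun w : List Bool => w) (fun q : ℚ => (Literature.Computability.Complexity.encodingIntBool.pairBool Computability.encodingNatBool).encode (q.num, q.den)) d ∧ ∀ L ∈ Literature.Computability.Complexity.E, ∀ c : ℕ, ∃ N : ℕ, (c : ℚ) < d ((List.range N).map fun i => decide ((Nat.bits (i + 1)).reverse.tail ∈ L))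

/-- item stmt-QuantumAdvantage-1358 · assembly · rank 1 · open · by planner
sources: VanMelkebeek2000, BernsteinVazirani1997SICOMP
[assembly] vM's law (crux r2, a theorem in print) + QMH (r3) + BQP ≠ EXP (r5) ⟹ the summit: by
contradiction, ¬S gives BQP ⊆ BPP, with the PROVED tree fact BPP_subset_BQP_holds BQP = BPP;
rewriting, ¬PMZ BPP, so vM's disjunction yields BPP = EXP = BQP, contradicting r5. Two lines after
`rw`; proved in the planner's Sketch.lean against BPP ⊆ BQP. No witness language is named (existence
by measure). -/
@[route_item "route-QuantumAdvantage-MeasureZeroOne"]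
def Assembly : Prop :=
  ZeroOneLawBPP → BQPNotSmall → BQPneEXP → QuantumAdvantage

/-! D-0027 §2.1 — DECIDING THEOREM (planner-authored via `route open/edit --closes-file`; by planner-rbadge-QuantumAdvantage-MeasureZeroOne-16f136f9-g2-0 2026-08-15T16:11:53Z):
its hypotheses are this route's items and its conclusion the sub-problem Statement (glue_lint), and it elaborates with this file. -/

@[closes "route-QuantumAdvantage-MeasureZeroOne"] theorem closes (h₁ : ZeroOneLawBPP) (h₂ : BQPNotSmall) (h₃ : BQPneEXP) : QuantumAdvantage := by
  -- by contradiction: ¬S gives BQP ⊆ BPP, hence BQP = BPP with the proved Literature theorem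
  -- `BPP_subset_BQP_holds` (Bernstein–Vazirani 1997, Thm. 8.3; SimUniformity.lean);
  -- rewriting vM's zero-one law for BPP (h₁) along BQP = BPP, its first disjunct is ¬h₂ (QMH)
  -- and its second is ¬h₃ (BQP ≠ EXP).
  by_contra hS
  have heq : Literature.Computability.Cryptography.BQP = Literature.Computability.Complexity.BPP :=
    Set.Subset.antisymm (fun L hL => by_contra fun hL' => hS ⟨L, hL, hL'⟩)
      Literature.Computability.QuantumComplexity.BPP_subset_BQP_holds
  unfold ZeroOneLawBPP at h₁
  unfold BQPNotSmall at h₂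
  unfold BQPneEXP at h₃
  rw [← heq] at h₁
  exact h₁.elim h₂ h₃

end Summit.QuantumAdvantage.QuantumAdvantage.Theses.MeasureZeroOne
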